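import Summits.Ventures.HSemireg.Pad4TowerXStaticSafe2
import Summits.Ventures.HSemireg.Pad4TowerAlphabetMu4

/-!
# Venture HSemireg — PAD-4: the static screen's admissibility implies THEOREM X∞'s admissibility inside 𝒰

HONEST FRAMING. Lean index of the computation cell `pub-hsemireg` (S4-PUSH, H2 door PAD-4), typed by the Ventures-side typer
`hodge-lit-semireg-typer-2` (g3), on line stmt-HodgeConjecture-18881 ∕ `Cruxes/BlochSeedDiscOne/Lines/birth.lean` 814a6a70c14e831a ∕
`stub_rung_pad4_seedAt` (screens (U)+(E1); card v4.2 29bde0fa5197dc62 row E6 «no new line inside 𝒰 + REDIRECT outside it»). A SEAM between two typed notions of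
«admissible support» that the cell uses side by side: the STATIC SCREEN's (gs-eng-2: RULE-D-closed, two-sided X-clean in READING p, G-invariant —
`Pad4TowerXStaticSafe2.XAdmissible`, the hypothesis of LEMMA SAFE2) and THEOREM X∞'s on 𝔅(μ₄) (bc5-plan memo v4.1 (0.5): letters in 𝒰,
RULE-D-closed, PSC, X-clean bracket — `Pad4TowerAlphabetMu4.AdmissibleMu4`, hodge-semireg-assembly-p1 g1, row 806). PROVED here:

(1) `xInstP_of_xPhaseDeadMu4_apex`: when the `P`-letters lie in the cone of `O`, at an `O` demand factor `f` of `Z` and a charged `σ`, the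
§22-VERBATIM kill `XPhaseDeadMu4` IMPLIES the reading-p instance `XInstP` ((A1) `W_f(Z) = ∅` and (A2c) are vacuous under an apex factor, (H-e′)
verbatim implies its participant-exact form) — the converse of the (A1) separation of `Pad4TowerXStaticSafe2.instP_ne_xPhaseDeadMu4` in the one
situation THEOREM X∞ uses. (2) `xcleanMu4_of_noInstP`: reading-p immunity of the `N`-cells ⇒ the X-CLEAN bracket of (0.5) (through row 759's
`xPhaseDeadMu4_of_ray`, exactly as `xcleanMu4_of_immune`). (3) `pscMu4_of_gKeyRel_closed`: closure of the `N`-cells under the G-orbit key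
(`GKeyRel`, xinf.py `okey`) ⇒ PSC («every G-invariant support is PSC», memo (0.5); rotating one factor of a cell with an `O`-factor keeps the
key). (4) **`admissibleMu4_of_static`**: a support with letters in 𝒰 on both levels that is RULE-D-closed, reading-p-immune on its `N`-cells and
key-closed on its `N`-cells is `AdmissibleMu4`; in particular (`admissibleMu4_of_xAdmissible`) every static-screen-admissible support inside 𝒰 is —
so THEOREM X∞ on 𝔅(μ₄) (assembly-p1 g1, `AdmissibleMu4.junk` — filing tonight; once it lands, NOT imported here) applies to it: inside 𝒰 the
static screen's survivors that are admissible are then junk, which is the kernel form of the card's E6 pickup sentence. Outside 𝒰 (bare nodes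
`2kI`, non-simple towers — W1-Q1, director-hodge g10 l.31458) nothing is claimed.

NOT HERE: LEMMA SAFE2 itself (companion file), THEOREM X∞ (rows 806∕814∕816∕μ4), any (E1) meaning (pencil). Nothing is a statement about a
variety, a sheaf, `σ`, a seed or an abelian variety; NOTHING HERE SAYS THAT HC ∕ HC_CM ∕ HC_AV ∕ W₆ ∕ HC_Kum4Type HOLDS OR FAILS; census-neutral.
No `instance`, no notation, no named fact, 0 `sorry`; axioms standard. Typed ≠ proved ≠ endorsed.

SOURCES (sha16): `general-structure/LEMMA-SAFE2-gs2g50.md` 86089cd465aa28ed (§Setting); BC5-PLAN memo v4.1 df3e4f41db3c2fcf (0.5) (via row 806's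
docstrings); `Pad4TowerAlphabetMu4.lean` c80bb296ed09e528 (p570020: `InUMu4`, `rotPt`, `PSCMu4`, `XCleanMu4`, `AdmissibleMu4`,
`xcleanMu4_of_immune`); `Pad4TowerXPhaseMu4Unit.lean` (p? row 759: `xPhaseDeadMu4_of_ray`); `Pad4TowerXStaticSafe2.lean` 68d314e1bb2c6e36,
`Pad4TowerRuleDMu4Dual.lean` 007f634b1a5bb9b7 (this typer).
-/

namespace Summit.Ventures.HSemireg.Pad4Tower

open Finset

/-- nothing lies strictly null-below a letter of the cone of `O` at the apex: `NullBelow y O` needs `α(y) < 0`. -/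
theorem not_nullBelow_apex {y : BPoint} (hy : Effective y) : ¬ NullBelow y (0, 0, 0) := fun h => by
  have h1 := hy.1
  have h2 := h.1
  simp only at h2
  omega

/-- **verbatim ⇒ reading p at an apex demand factor.** If every `P`-letter is effective from `O`, `Z_f = O` and `Z_σ` is charged, the
§22-verbatim kill `XPhaseDeadMu4 C Z σ u f` implies the reading-p instance `XInstP C Z σ u f`. -/
theorem xInstP_of_xPhaseDeadMu4_apex {C : MConfig} (hcone : ∀ P ∈ C.upper, ∀ g, Effective (P g)) {Z : MCell} {σ k f : Fin 4}
    (hO : Z f = (0, 0, 0)) (hch : ¬ isApex (Z σ)) (h : XPhaseDeadMu4 C Z σ k f) : XInstP C Z σ k f := by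
  obtain ⟨hσf, hq, hpin⟩ := h
  refine ⟨hch, hσf, hq, fun P hP hnull => ?_, fun q hq' hqZ => ?_⟩
  · exact absurd (hO ▸ hnull) (not_nullBelow_apex (hcone P hP f))
  · obtain ⟨hconeq, n, hn, k', hk', hsib, hcomp, -⟩ := hpin q hq' hqZ
    exact ⟨n, hn, k', hk', hsib, hcomp, fun P hP hag _ _ _ => hconeq P hP hag,
      fun P hP _ hnull _ => absurd (hO ▸ hnull) (not_nullBelow_apex (hcone P hP f))⟩

/-- a charged ray letter is not an apex point. -/
theorem not_isApex_lpt {c : ℤ} (hc : 1 ≤ c) (k : Fin 4) : ¬ isApex (lpt c k) := by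
  fin_cases k <;> simp [isApex, lpt_eq] <;> omega

/-- **reading-p immunity ⇒ the X-CLEAN bracket of THEOREM X∞** (memo (0.5) (S-ii) with (0.4)): if the `P`-letters lie in the cone of `O`
and no `N`-cell carries a reading-p instance, the configuration is `XCleanMu4` — through `xPhaseDeadMu4_of_ray` (row 759) and
`xInstP_of_xPhaseDeadMu4_apex`. -/
theorem xcleanMu4_of_noInstP {C : MConfig} (hcone : ∀ P ∈ C.upper, ∀ g, Effective (P g))
    (himm : ∀ Z ∈ C.lower, ∀ σ k f, ¬ XInstP C Z σ k f) : XCleanMu4 C :=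
  fun Z hZ f σ hσf hO k _ hc hZσ ⟨hq, _, hk', hmid, hn⟩ =>
    himm Z hZ σ k f (xInstP_of_xPhaseDeadMu4_apex hcone hO (by rw [hZσ]; exact not_isApex_lpt hc k)
      (xPhaseDeadMu4_of_ray C hcone hσf hO hc hZσ hq hk' hmid hn))

/-- a phase rotation of one factor keeps the height … -/
theorem rotPt_fst (x : BPoint) (j : Fin 4) : (rotPt x j).1 = x.1 := rfl

/-- … and `|β|²`. -/
theorem bnormSq_rotPt (x : BPoint) (j : Fin 4) : bnormSq (rotPt x j) = bnormSq x := by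
  fin_cases j <;> simp [rotPt, bnormSq] <;> ring

/-- rotating the phase of one factor of a cell WITH AN `O`-FACTOR keeps the G-orbit key (the `O`-factor absorbs the product-one
condition: the cell is not fully charged). -/
theorem gKeyRel_update_rotPt (Z : MCell) (σ j : Fin 4) (hO : ∃ f, Z f = (0, 0, 0)) :
    GKeyRel Z (Function.update Z σ (rotPt (Z σ) j)) := by
  refine ⟨⟨Equiv.refl _, fun f => ?_⟩, fun hFC => ?_⟩
  · by_cases hf : f = σ
    · subst hf
      rw [Function.update_self]
      exact ⟨rotPt_fst _ _, bnormSq_rotPt _ _⟩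
    · rw [Function.update_of_ne hf]
      exact ⟨rfl, rfl⟩
  · obtain ⟨f₀, hf₀⟩ := hO
    exact absurd (show isApex (Z f₀) by rw [hf₀]; decide) (hFC f₀)

/-- **key-closure ⇒ PSC** (memo (0.5): «every G-invariant support is PSC»): if the `N`-cells are closed under the G-orbit key, every
phase rotation of every factor of an `N`-cell with an `O`-factor is an `N`-cell. -/
theorem pscMu4_of_gKeyRel_closed {C : MConfig} (hcl : ∀ Z ∈ C.lower, ∀ n, GKeyRel Z n → n ∈ C.lower) : PSCMu4 C :=
  fun Z hZ hO σ j => hcl Z hZ _ (gKeyRel_update_rotPt Z σ j hO)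

/-- **THE SEAM.** A 𝔅(μ₄) configuration with letters in 𝒰 on both levels, RULE-D-closed (row 771), with no reading-p instance on its
`N`-cells and `N`-cells closed under the G-orbit key, satisfies the hypotheses `AdmissibleMu4` of THEOREM X∞ on 𝔅(μ₄) (row 806). -/
theorem admissibleMu4_of_static {C : MConfig} (huN : ∀ Z ∈ C.lower, ∀ f, InUMu4 (Z f))
    (huP : ∀ P ∈ C.upper, ∀ f, InUMu4 (P f)) (hD : RuleDMu4Closed C)
    (himm : ∀ Z ∈ C.lower, ∀ σ k f, ¬ XInstP C Z σ k f) (hcl : ∀ Z ∈ C.lower, ∀ n, GKeyRel Z n → n ∈ C.lower) :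
    AdmissibleMu4 C where
  uN := huN
  uP := huP
  ruleD := hD
  psc := pscMu4_of_gKeyRel_closed hcl
  xclean := xcleanMu4_of_noInstP (fun P hP g => (huP P hP g).effective) himm

/-- **static-screen admissibility ⇒ X∞ admissibility inside 𝒰**: an `XAdmissible GKeyRel h` support (the hypothesis of LEMMA SAFE2 for
the engines' key) whose letters lie in 𝒰 is `AdmissibleMu4`. (Only (S-i), the `N`-side of (S-ii) and the `N`-side of (S-iii) are used.) -/
theorem admissibleMu4_of_xAdmissible {h : ℤ} {T : MConfig} (hT : XAdmissible GKeyRel h T)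
    (huN : ∀ Z ∈ T.lower, ∀ f, InUMu4 (Z f)) (huP : ∀ P ∈ T.upper, ∀ f, InUMu4 (P f)) : AdmissibleMu4 T :=
  admissibleMu4_of_static huN huP hT.ruleD hT.cleanN hT.closedN

end Summit.Ventures.HSemireg.Pad4Tower
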